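import Mathlib
import Summits.ValiantsHypothesis.ValiantsHypothesis.Theorems.GrenetZeonTwoDimCoefficientsScalingRayGeneral
import Summits.ValiantsHypothesis.ValiantsHypothesis.Theorems.GrenetZeonTwoDimCoefficientsScalingIndexTopNumerator

/-!
# Crux `GrenetZeon.TwoDimCoefficients` (stmt-ValiantsHypothesis-8062), stub `stub_dualUnipotent`:
# scaling-closure — the per-free engine on an index-`n` pencil with an ARBITRARY affine numerator (EIGHTEENTH-HAND.md, step 4)

For an index-`n` pencil `A = A₀(1 − N)` (`Nⁿ = 0`, `det A = c`) and ANY affine `B′`, the top companions of `(A, B′)` at a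
point `z₀` are the coefficients of the complex polynomial
`R_{z₀}(u) = c·det(1_m + u·N(z₀)^{n−1}·P₀·B′₁(z₀))` (`B′₁` = linear part of `B′`).  If `rank N(z)^{n−1} ≤ r` everywhere
(`1 ≤ r ≤ m`) and `R_{z₀}` has `r` distinct non-zero simple roots, the per-free engine
(✓ `exists_shadowFamily_general`, ✓ `rank_hess0_top_le_of_simpleRayRoots`, ✓ `topCompanion_eq_zero_of_rank_lt`) gives

* ★ `rank_hess0_top_le_of_perturbedRay` — `rank Hess [tr(adj A·B′)]_n (z₀) ≤ r·(2m)`.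

In the numerator-perturbation argument this is applied to `B′ = θ·B + C`, where `[tr(adj A·B′)]_n = θβ⁻¹·per_n + q`.

HONEST FRAMING: engine step; the stub `DualUnipotentBound`, both cruxes (stmt-8062, stmt-24318) and `VP ≠ VNP` remain
open.

References: T. Mignon, N. Ressayre, Int. Math. Res. Not. 2004:79, Thm. 1.1 (via the tree); folklore.
-/

-- single-conjunct layout `Summits/ValiantsHypothesis/ValiantsHypothesis`: the duplicated namespace
-- component is mandated by the tree.
set_option linter.dupNamespace false
set_option autoImplicit false

noncomputable section

namespace Summit.ValiantsHypothesis.ValiantsHypothesis.Theorems.GrenetZeonTwoDimCoefficients.ScalingClosure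

open MvPolynomial Matrix
open Literature.Computability.AlgebraicComplexity
open Summit.ValiantsHypothesis.ValiantsHypothesis.Cruxes.TwoDimCoefficients.DimTwoCases

section PerturbedRay

variable {n m : ℕ}

/-- **Top companions of `(A, B′)` at a point are the coefficients of `c·det(1 + u·N₀P₀B′₁(z₀))`.** [folklore] -/
theorem eval_topCompanion_eq_coeff (hn : 1 ≤ n) (A₀ P₀ : Matrix (Fin m) (Fin m) ℂ) (hP₀ : A₀ * P₀ = 1)
    (N : AffMat n m) (hN : ∀ i j, (N i j).IsHomogeneous 1) (hNn : N ^ n = 0) (A : AffMat n m)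
    (hAN : A = A₀.map MvPolynomial.C * (1 - N)) (c : ℂ) (hc : c ≠ 0) (hdet : A.det = MvPolynomial.C c)
    (B' : AffMat n m) (hB' : IsAffine B') (z₀ : Fin n × Fin n → ℂ) (j : ℕ) :
    eval z₀ (homogeneousComponent (j * n) ((det ((Polynomial.X : Polynomial (MvPolynomial (Fin n × Fin n) ℂ)) •
      B'.map Polynomial.C + A.map Polynomial.C)).coeff j)) =
    (Polynomial.C c * (-(((N.map (eval z₀)) ^ (n - 1)) *
      (P₀ * (Matrix.of fun a b => homogeneousComponent 1 (B' a b)).map (eval z₀)))).charpolyRev).coeff j := by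
  classical
  have hadj : ∀ i j, (A.adjugate i j).totalDegree ≤ n - 1 :=
    totalDegree_adjugate_le_of_index hn A₀ P₀ hP₀ N hN hNn A hAN c hc hdet
  have hP : ∀ i j, ((A.adjugate * B') i j).totalDegree ≤ n := fun i j =>
    (totalDegree_adjugate_mul_le A B' (n - 1) hadj hB' i j).trans (by omega)
  set B1 : AffMat n m := Matrix.of fun a b => homogeneousComponent 1 (B' a b) with hB1
  set Ptop : AffMat n m := Matrix.of fun i j => homogeneousComponent n ((A.adjugate * B') i j) with hPtop
  rw [topCompanion_eq A B' c hc hdet hP Ptop (fun i j => rfl) j, map_mul, MvPolynomial.eval_C,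
    Polynomial.coeff_C_mul, ← Polynomial.coeff_map, ← charpolyRev_map]
  congr 3
  rw [Matrix.map_neg _ (map_neg (eval z₀))]
  congr 1
  apply Matrix.ext; intro i j
  rw [Matrix.map_apply, Matrix.smul_apply, hPtop, Matrix.of_apply,
    homogeneousComponent_adjugate_mul_of_index hn A₀ P₀ hP₀ N hN hNn A hAN c hc hdet B' hB' B1 (fun a b => rfl),
    smul_eq_mul, map_mul, map_mul, MvPolynomial.eval_C, MvPolynomial.eval_C, ← mul_assoc, inv_mul_cancel₀ hc, one_mul]
  have hP₀ev : (P₀.map MvPolynomial.C : AffMat n m).map (eval z₀) = P₀ := by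
    apply Matrix.ext; intro a b
    rw [Matrix.map_apply, Matrix.map_apply, MvPolynomial.eval_C]
  show ((N ^ (n - 1) * (P₀.map MvPolynomial.C * B1)).map (eval z₀)) i j = _
  rw [Matrix.map_mul, Matrix.map_mul, Matrix.map_pow, hP₀ev]

/-- ★ **Per-free engine on an index-`n` pencil with an arbitrary affine numerator.**  If `rank N(z)^{n−1} ≤ r` for all
`z` (`1 ≤ r ≤ m`, `n ≥ 2`) and at `z₀` the polynomial `c·det(1 + u·N(z₀)^{n−1}P₀B′₁(z₀))` has `r` distinct non-zero
simple roots, then `rank Hess [tr(adj A·B′)]_n (z₀) ≤ r·(2m)`. [cite: MignonRessayre2004, Thm. 1.1 — via the tree; folklore] -/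
theorem rank_hess0_top_le_of_perturbedRay (hn : 2 ≤ n) (A₀ P₀ : Matrix (Fin m) (Fin m) ℂ) (hP₀ : A₀ * P₀ = 1)
    (N : AffMat n m) (hN : ∀ i j, (N i j).IsHomogeneous 1) (hNn : N ^ n = 0) (A : AffMat n m)
    (hAN : A = A₀.map MvPolynomial.C * (1 - N)) (hA : IsAffine A) (c : ℂ) (hc : c ≠ 0)
    (hdet : A.det = MvPolynomial.C c) (B' : AffMat n m) (hB' : IsAffine B')
    {r : ℕ} (hr1 : 1 ≤ r) (hrm : r ≤ m) (hr : ∀ z : Fin n × Fin n → ℂ, (((N.map (eval z)) ^ (n - 1))).rank ≤ r)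
    (z₀ : Fin n × Fin n → ℂ) (t : Fin r → ℂ) (ht : Function.Injective t) (ht0 : ∀ i, t i ≠ 0)
    (Rz : Polynomial ℂ)
    (hRz : Rz = Polynomial.C c * (-(((N.map (eval z₀)) ^ (n - 1)) *
      (P₀ * (Matrix.of fun a b => homogeneousComponent 1 (B' a b)).map (eval z₀)))).charpolyRev)
    (hroot : ∀ i, Rz.eval (t i) = 0) (hder : ∀ i, (Polynomial.derivative Rz).eval (t i) ≠ 0) :
    (hess0 (transl z₀ (homogeneousComponent n ((det ((Polynomial.X : Polynomial (MvPolynomial (Fin n × Fin n) ℂ)) •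
      B'.map Polynomial.C + A.map Polynomial.C)).coeff 1)))).rank ≤ r * (2 * m) := by
  classical
  set D : ℕ → MvPolynomial (Fin n × Fin n) ℂ := fun k =>
    (det ((Polynomial.X : Polynomial (MvPolynomial (Fin n × Fin n) ℂ)) • B'.map Polynomial.C +
      A.map Polynomial.C)).coeff k with hDdef
  have hD : ∀ k, D k = (det ((Polynomial.X : Polynomial (MvPolynomial (Fin n × Fin n) ℂ)) •
      B'.map Polynomial.C + A.map Polynomial.C)).coeff k := fun k => rfl
  have hu : IsUnit A.det := by rw [hdet]; exact (isUnit_iff_ne_zero.mpr hc).map MvPolynomial.C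
  have hD0 : D 0 = MvPolynomial.C c := by rw [hD, coeff_det_zero, hdet]
  have hadj : ∀ i j, (A.adjugate i j).totalDegree ≤ n - 1 :=
    totalDegree_adjugate_le_of_index (by omega) A₀ P₀ hP₀ N hN hNn A hAN c hc hdet
  have hP : ∀ i j, ((A.adjugate * B') i j).totalDegree ≤ n := fun i j =>
    (totalDegree_adjugate_mul_le A B' (n - 1) hadj hB' i j).trans (by omega)
  -- degree bookkeeping for every `k`
  have hdeg : ∀ k, ∀ d, k * n < d → homogeneousComponent d (D k) = 0 := by
    intro k d hkd
    rcases k with _ | _ | k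
    · rw [hD0, homogeneousComponent_of_mem (isHomogeneous_C (Fin n × Fin n) c), if_neg (by omega)]
    · refine homogeneousComponent_eq_zero _ _ ?_
      rw [hD, coeff_det_one A B' hu, Matrix.trace]
      refine (totalDegree_finsetSum _ _).trans_lt (lt_of_le_of_lt (Finset.sup_le fun i _ => ?_) (by omega : n < d))
      exact hP i i
    · exact hdeg_of_index (by omega) A₀ P₀ hP₀ N hN hNn A B' hAN hB' c hc hdet D hD (k + 2) (by omega) d hkd
  have hJ : ∀ k, r < k → k ≤ m → homogeneousComponent (k * n) (D k) = 0 := fun k hk _ =>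
    topCompanion_eq_zero_of_rank_lt (by omega) A₀ P₀ hP₀ N hN hNn A hAN c hc hdet B' hB' hr D hD hk
  -- coefficients of `Rz`
  have hcoef : ∀ j, eval z₀ (homogeneousComponent (j * n) (D j)) = Rz.coeff j := fun j => by
    rw [hRz, hD]
    exact eval_topCompanion_eq_coeff (by omega) A₀ P₀ hP₀ N hN hNn A hAN c hc hdet B' hB' z₀ j
  have hRz0 : Rz.coeff 0 = c := by
    rw [← hcoef 0, zero_mul, hD0, homogeneousComponent_of_mem (isHomogeneous_C (Fin n × Fin n) c), if_pos rfl,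
      MvPolynomial.eval_C]
  have hRzdeg : Rz.natDegree ≤ r := by
    rw [Polynomial.natDegree_le_iff_coeff_eq_zero]
    intro j hj
    have hj' : r < j := by exact_mod_cast hj
    rw [hRz, Polynomial.coeff_C_mul, coeff_charpolyRev_eq_zero_of_rank_lt _ ?_, mul_zero]
    rw [← Matrix.mul_neg]
    exact ((Matrix.rank_mul_le_left _ _).trans (hr z₀)).trans_lt hj'
  -- root and simplicity conditions in the engine's format
  have hroot' : ∀ i, c + ∑ e : Fin r, t i ^ ((e : ℕ) + 1) *
      eval z₀ (homogeneousComponent (((e : ℕ) + 1) * n) (D (e + 1))) = 0 := by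
    intro i
    have h := hroot i
    rw [Polynomial.eval_eq_sum_range' (Nat.lt_succ_of_le hRzdeg), Finset.sum_range_succ', pow_zero, mul_one,
      hRz0, add_comm] at h
    rw [← h, Fin.sum_univ_eq_sum_range (fun e => t i ^ (e + 1) * eval z₀ (homogeneousComponent ((e + 1) * n) (D (e + 1))))]
    congr 1
    exact Finset.sum_congr rfl fun e _ => by rw [hcoef, mul_comm]
  have hsimple' : ∀ i, ∑ e : Fin r, (((e : ℕ) + 1 : ℕ) : ℂ) * (t i ^ ((e : ℕ) + 1) *
      eval z₀ (homogeneousComponent (((e : ℕ) + 1) * n) (D (e + 1)))) ≠ 0 := by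
    intro i
    have hdd : (Polynomial.derivative Rz).natDegree < r :=
      lt_of_le_of_lt (Polynomial.natDegree_derivative_le Rz) (by omega)
    have h : t i * (Polynomial.derivative Rz).eval (t i) = ∑ e : Fin r, (((e : ℕ) + 1 : ℕ) : ℂ) *
        (t i ^ ((e : ℕ) + 1) * eval z₀ (homogeneousComponent (((e : ℕ) + 1) * n) (D (e + 1)))) := by
      rw [Polynomial.eval_eq_sum_range' hdd, Finset.mul_sum,
        Fin.sum_univ_eq_sum_range (fun e => (((e : ℕ) + 1 : ℕ) : ℂ) *
          (t i ^ (e + 1) * eval z₀ (homogeneousComponent ((e + 1) * n) (D (e + 1)))))]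
      refine Finset.sum_congr rfl fun e _ => ?_
      rw [Polynomial.coeff_derivative, hcoef]
      push_cast
      ring
    rw [← h]
    exact mul_ne_zero (ht0 i) (hder i)
  have h := rank_hess0_top_le_of_simpleRayRoots A B' hA hB' c hn D hD hD0 hdeg hr1 hrm hJ z₀ t ht hroot' hsimple'
  simpa only [one_mul] using h

end PerturbedRay

end Summit.ValiantsHypothesis.ValiantsHypothesis.Theorems.GrenetZeonTwoDimCoefficients.ScalingClosure

end
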